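/-
Copyright (c) 2026 the pub-hodgecm-mathlib formalisation cell (harness21).  Prover seat hodgecm-mathlib-F0P2-p01 (g15): road «S3-ram» (LEAD F0P3a-plan (g12); architect
A-p16 (g31); owner F0P3a-p06 (g15)), organ A′ (ii): J6 LABEL SIDE of the (a2) junction (F0P3a-p01 (g16) J-PACK 23:57:42Z; counts side F0P2-p06 (g12)); 2026-09-02.
-/
import Literature.NumberTheory.Automorphic.UnitaryLatticeTreeFixedChildTokensRamified   -- ★ p847340 (this seat): FILE H tokens dictionary; brings ★ G p847277, ★ G′ p847295, ★ F p847187, ★ E p847102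
import HarnessLib

/-!
# The lattice graph of a hermitian space — THE PIVOT OF A FIXED CHILD AT A TAME-RAMIFIED PLACE: a deeper neighbour makes its line an eigenline, and through a null line
# off the kernel of a residually nilpotent element the child has rank two (Bruhat–Tits 1972 §10; Tits 1979 §3.5; Kottwitz 1986 §3)

Topic `NumberTheory/Automorphic`; namespace `Literature.NumberTheory.Automorphic.UnitaryLatticeTree`.  THEOREMS ONLY (no definition, no instance, no notation, no named fact,
no `sorry`); kernel lane `--supports stmt-HodgeConjecture-24833`.  Cell `pub/hodgecm-mathlib` (D-0151), crux H413; road «S3-ram» (Literature seeding, count-neutral), organ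
A′ (ii) of the P-1-ram skeleton (architect A-p16 (g31)); the LABEL side of junction item J6 («local law in engine shape», the `hE`∕`hO`∕`hR` rows of ★ p847302): the child of a
rank-2 vertex through an OUTWARD NULL line has rank 2 and depth exactly `d − 1`.  ★ H (`not_map_sub_one_childLatt_le_scaleLattice_of_pivot`,
`map_sub_one_sq_childLatt_le_scaleLattice_iff_of_corner`) reduce this to the PIVOT `|M₁₀| = |ϖ|^d` (`M = κ⁻¹(γ−1)κ` in the unitary frame `κ` adapted to the line `x̄ = κe₀`),
i.e. residually `Ȳx̄ ∉ 𝓀x̄`.  THIS FILE supplies the pivot from lattice-intrinsic data, with NO history of the induction: §1 a neighbour `Λ′ = κ·(N₁ + 𝒪w(a,b))` through `x̄`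
that is at least as deep as the vertex (`(γ−1)Λ′ ⊆ ϖ^dΛ′` — e.g. the PARENT of a non-root fixed vertex, read as a «child» through the INWARD line) forces
`M₁₀ ≡ M₂₁ ≡ M₂₀ ≡ 0 (ϖ^{d+1})`: the inward line is an EIGENLINE of `Ȳ` (`Ȳx̄ = ȳ₀₀x̄`); §2 if `Ȳ` is residually NILPOTENT (`(γ−1)³` of level `ϖ^{3d+1}`, the regime off the
root region) then an eigenline is a KERNEL line (`ȳ₀₀ = 0`, as `(M³)₀₀ ≡ M₀₀³`), so a null line `x̄ ∉ ker Ȳ` carries the pivot `|M₁₀| = |ϖ|^d`; §3 the token corollary: through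
such a line the child has `¬ LEV (ϖ^d)` and `¬ LEV₂ (ϖ^{2d−1})` — label `(d − 1, rank 2)`, the `E_m → O_{m−1}` and `O_m → E_m` rows (CERT smoke v1.3 §6, A-p16 (g31)); with
F0P2-p06 (g12)'s ★ `exists_smul_eq_of_mulVec_eq_zero_of_sq_ne_zero` (rank 2 ⇒ the kernel is ONE line) and §1 (that line is the inward one) every OUTWARD null line qualifies.

* §1 **`v_apply_le_succ_of_forall_v_childFrame_conj_le`** (matrix form), **`v_apply_le_succ_of_map_sub_one_childLatt_le`** (token form: `LEV (ϖ^d) Λ′ ⇒` eigenline).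
* §2 `v_mul_mul_apply_zero_zero_sub_le` (`|(M³)₀₀ − M₀₀³| ≤ |ϖ|^{3d+1}` on an eigenline), **`v_one_zero_eq_of_cube_le_of_corner`** (nilpotent + null + not kernel ⇒ pivot).
* §3 **`not_lev_and_not_lev₂_childLatt_of_cube_le`** (the child through an outward null line off the kernel has depth exactly `d − 1` and rank 2, in tokens).

HONEST LABEL: HC_CM is proved only modulo the 2 remaining named inputs (hLiu418 24832, h413 24833) until rung 0 closes; nothing printed is asserted here (elementary algebra
over a valuation ring); «S3-ram» has no books consequence.

## References
* [BruhatTits1972] F. Bruhat, J. Tits, *Groupes réductifs sur un corps local I*, Publ. Math. IHÉS 41 (1972), §10 (lattice models; vertex stabilisers and their filtrations).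
* [Tits1979] J. Tits, *Reductive groups over local fields*, PSPM 33.1 (1979), §3.5 (congruence filtration; reduction mod `𝔭`).
* [Kottwitz1986] R. E. Kottwitz, *Base change for unit elements of Hecke algebras*, Compositio Math. 60 (1986), §3 (levels of fixed lattices; shell recursion).
* [Serre1980Trees] J.-P. Serre, *Trees* (1980), Ch. II §1.1–1.2 (lattices, neighbours, levels).
-/

set_option autoImplicit false

noncomputable section

open scoped Valued WithZero Matrix MatrixGroups

namespace Literature.NumberTheory.Automorphic.UnitaryLatticeTree

open Literature.NumberTheory.Automorphic Literature.NumberTheory.Automorphic.HermitianLattice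

variable {K : Type*} [Field K] [Valued K ℤᵐ⁰] {σ : K →+* K} {ϖ : K}

/-! ## §1 A deeper neighbour makes the line an eigenline -/

/-- **A DEEPER NEIGHBOUR MAKES THE LINE AN EIGENLINE** (matrix form): if `M` has level `ϖ^d` (`d ≥ 1`) and `M′ = g⁻¹Mg` ALSO has level `ϖ^d` (the neighbour `latt(κ·g(a,b))`
through `x̄ = κe₀` is at least as deep), then `|M₁₀|, |M₂₁|, |M₂₀| ≤ |ϖ|^{d+1}`: residually `Ȳx̄ = ȳ₀₀x̄`.  Read with the PARENT of a non-root fixed vertex as the neighbour: the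
inward line is an eigenline of `Ȳ`. [cite: Kottwitz1986, §3] [cite: Tits1979, §3.5] [cite: Serre1980Trees, II.1.1] -/
theorem v_apply_le_succ_of_forall_v_childFrame_conj_le (hϖ : Valued.v ϖ = WithZero.exp (-1 : ℤ)) {a b : K} (ha : Valued.v a = 1) (hb : Valued.v b ≤ 1)
    {d : ℕ} (hd : 1 ≤ d) {M : Matrix (Fin 3) (Fin 3) K} (hM : ∀ i j, Valued.v (M i j) ≤ Valued.v ϖ ^ d)
    (hM' : ∀ i j, Valued.v (((!![ϖ / a, 0, 0; 0, 1, 0; -b / a, 0, ϖ⁻¹] : Matrix (Fin 3) (Fin 3) K) * M * !![a / ϖ, 0, 0; 0, 1, 0; b, 0, ϖ]) i j) ≤ Valued.v ϖ ^ d) :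
    Valued.v (M 1 0) ≤ Valued.v ϖ ^ (d + 1) ∧ Valued.v (M 2 1) ≤ Valued.v ϖ ^ (d + 1) ∧ Valued.v (M 2 0) ≤ Valued.v ϖ ^ (d + 1) := by
  have hϖ0 : ϖ ≠ 0 := fun h0 => by rw [h0, map_zero] at hϖ; exact WithZero.coe_ne_zero hϖ.symm
  have hvϖ0 : Valued.v ϖ ≠ 0 := (Valuation.ne_zero_iff _).2 hϖ0
  have ha0 : a ≠ 0 := fun h0 => by rw [h0, map_zero] at ha; exact zero_ne_one ha
  have hϖ1 : Valued.v ϖ ≤ 1 := by rw [hϖ, ← WithZero.exp_zero]; exact WithZero.exp_le_exp.2 (by norm_num)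
  have hd1 : Valued.v ϖ ^ (d + 1) = Valued.v ϖ * Valued.v ϖ ^ d := by rw [pow_succ']
  have hd2 : Valued.v ϖ ^ (d + 1) = Valued.v ϖ ^ 2 * Valued.v ϖ ^ (d - 1) := by rw [← pow_add]; congr 1; omega
  -- undo a `ϖ⁻¹`: `|ϖ⁻¹·x| ≤ |ϖ|^d ⇒ |x| ≤ |ϖ|^(d+1)`
  have hup : ∀ {x : K}, Valued.v (ϖ⁻¹ * x) ≤ Valued.v ϖ ^ d → Valued.v x ≤ Valued.v ϖ ^ (d + 1) := fun {x} hx => by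
    rw [map_mul, map_inv₀] at hx
    have h' := mul_le_mul' (le_refl (Valued.v ϖ)) hx
    rwa [← mul_assoc, mul_inv_cancel₀ hvϖ0, one_mul, ← hd1] at h'
  -- (1,0): `|M′₁₀ − (a/ϖ)M₁₀| ≤ |ϖ|^d`
  have h10 : Valued.v (M 1 0) ≤ Valued.v ϖ ^ (d + 1) := by
    have hsub := v_childFrame_conj_one_zero_sub_le hϖ ha hb hM
    have hx : Valued.v (a / ϖ * M 1 0) ≤ Valued.v ϖ ^ d := by
      have e : a / ϖ * M 1 0 = ((!![ϖ / a, 0, 0; 0, 1, 0; -b / a, 0, ϖ⁻¹] : Matrix (Fin 3) (Fin 3) K) * M * !![a / ϖ, 0, 0; 0, 1, 0; b, 0, ϖ]) 1 0 -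
          ((((!![ϖ / a, 0, 0; 0, 1, 0; -b / a, 0, ϖ⁻¹] : Matrix (Fin 3) (Fin 3) K) * M * !![a / ϖ, 0, 0; 0, 1, 0; b, 0, ϖ]) 1 0 - a / ϖ * M 1 0)) := by ring
      rw [e]; exact (Valuation.map_sub _ _ _).trans (max_le (hM' 1 0) hsub)
    have e : a / ϖ * M 1 0 = a * (ϖ⁻¹ * M 1 0) := by field_simp
    rw [e, map_mul, ha, one_mul] at hx
    exact hup hx
  -- (2,1): `|M′₂₁ − ϖ⁻¹M₂₁| ≤ |ϖ|^d`
  have h21 : Valued.v (M 2 1) ≤ Valued.v ϖ ^ (d + 1) := by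
    have hsub := v_childFrame_conj_two_one_sub_le hϖ ha hb hM
    have hx : Valued.v (ϖ⁻¹ * M 2 1) ≤ Valued.v ϖ ^ d := by
      have e : ϖ⁻¹ * M 2 1 = ((!![ϖ / a, 0, 0; 0, 1, 0; -b / a, 0, ϖ⁻¹] : Matrix (Fin 3) (Fin 3) K) * M * !![a / ϖ, 0, 0; 0, 1, 0; b, 0, ϖ]) 2 1 -
          ((((!![ϖ / a, 0, 0; 0, 1, 0; -b / a, 0, ϖ⁻¹] : Matrix (Fin 3) (Fin 3) K) * M * !![a / ϖ, 0, 0; 0, 1, 0; b, 0, ϖ]) 2 1 - ϖ⁻¹ * M 2 1)) := by ring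
      rw [e]; exact (Valuation.map_sub _ _ _).trans (max_le (hM' 2 1) hsub)
    exact hup hx
  -- (2,0): `|M′₂₀ − L₂₀| ≤ |ϖ|^d`, `L₂₀ = (a/ϖ²)M₂₀ + (b/ϖ)(M₂₂ − M₀₀)`, the second term `≤ |ϖ|^(d-1)`
  have h20 : Valued.v (M 2 0) ≤ Valued.v ϖ ^ (d + 1) := by
    have hsub := v_childFrame_conj_sub_lower_le hϖ ha hb hM 2 0
    rw [Matrix.sub_apply] at hsub
    have hL : Valued.v (a / ϖ ^ 2 * M 2 0 + b / ϖ * (M 2 2 - M 0 0)) ≤ Valued.v ϖ ^ d := by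
      have e : a / ϖ ^ 2 * M 2 0 + b / ϖ * (M 2 2 - M 0 0) =
          ((!![ϖ / a, 0, 0; 0, 1, 0; -b / a, 0, ϖ⁻¹] : Matrix (Fin 3) (Fin 3) K) * M * !![a / ϖ, 0, 0; 0, 1, 0; b, 0, ϖ]) 2 0 -
          ((((!![ϖ / a, 0, 0; 0, 1, 0; -b / a, 0, ϖ⁻¹] : Matrix (Fin 3) (Fin 3) K) * M * !![a / ϖ, 0, 0; 0, 1, 0; b, 0, ϖ]) 2 0 -
            (!![0, 0, 0; a / ϖ * M 1 0, 0, 0; a / ϖ ^ 2 * M 2 0 + b / ϖ * (M 2 2 - M 0 0), ϖ⁻¹ * M 2 1, 0] : Matrix (Fin 3) (Fin 3) K) 2 0)) := by simp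
      rw [e]; exact (Valuation.map_sub _ _ _).trans (max_le (hM' 2 0) hsub)
    have htail : Valued.v (b / ϖ * (M 2 2 - M 0 0)) ≤ Valued.v ϖ ^ (d - 1) := by
      have e : b / ϖ * (M 2 2 - M 0 0) = b * (ϖ⁻¹ * (M 2 2 - M 0 0)) := by field_simp
      rw [e, map_mul]
      refine (mul_le_of_le_one_left zero_le hb).trans ?_
      rw [map_mul, map_inv₀]
      have hd' : Valued.v ϖ ^ d = Valued.v ϖ * Valued.v ϖ ^ (d - 1) := by rw [← pow_succ']; congr 1; omega
      calc (Valued.v ϖ)⁻¹ * Valued.v (M 2 2 - M 0 0) ≤ (Valued.v ϖ)⁻¹ * Valued.v ϖ ^ d :=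
            mul_le_mul' le_rfl ((Valuation.map_sub _ _ _).trans (max_le (hM 2 2) (hM 0 0)))
        _ = Valued.v ϖ ^ (d - 1) := by rw [hd', ← mul_assoc, inv_mul_cancel₀ hvϖ0, one_mul]
    have hc : Valued.v (a / ϖ ^ 2 * M 2 0) ≤ Valued.v ϖ ^ (d - 1) := by
      have e : a / ϖ ^ 2 * M 2 0 = (a / ϖ ^ 2 * M 2 0 + b / ϖ * (M 2 2 - M 0 0)) - b / ϖ * (M 2 2 - M 0 0) := by ring
      rw [e]
      exact (Valuation.map_sub _ _ _).trans (max_le (hL.trans (pow_le_pow_right_of_le_one' hϖ1 (by omega))) htail)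
    rw [map_mul, map_div₀, map_pow, ha, one_div] at hc
    have h' := mul_le_mul' (le_refl (Valued.v ϖ ^ 2)) hc
    rwa [← mul_assoc, mul_inv_cancel₀ (pow_ne_zero _ hvϖ0), one_mul, ← hd2] at h'
  exact ⟨h10, h21, h20⟩

/-- **A DEEPER NEIGHBOUR MAKES THE LINE AN EIGENLINE** (token form): if `(γ−1)·Λ′ ⊆ ϖ^d·Λ′` for the neighbour `Λ′ = latt(κ·g(a,b))` through `x̄ = κe₀` and `M = κ⁻¹(γ−1)κ` has
level `ϖ^d` (`d ≥ 1`), then `|M₁₀|, |M₂₁|, |M₂₀| ≤ |ϖ|^{d+1}`. [cite: Kottwitz1986, §3] [cite: Tits1979, §3.5] -/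
theorem v_apply_le_succ_of_map_sub_one_childLatt_le (hϖ : Valued.v ϖ = WithZero.exp (-1 : ℤ)) (κ γ : GL (Fin 3) K) {a b : K} (ha : Valued.v a = 1) (hb : Valued.v b ≤ 1)
    {d : ℕ} (hd : 1 ≤ d) (hM : ∀ i j, Valued.v (((((κ⁻¹ : GL (Fin 3) K)) : Matrix (Fin 3) (Fin 3) K) * ((γ : Matrix (Fin 3) (Fin 3) K) - 1) * (κ : Matrix (Fin 3) (Fin 3) K)) i j) ≤ Valued.v ϖ ^ d)
    (hlev : (latt ((κ : Matrix (Fin 3) (Fin 3) K) * !![a / ϖ, 0, 0; 0, 1, 0; b, 0, ϖ])).map ((Matrix.toLin' ((γ : Matrix (Fin 3) (Fin 3) K) - 1)).restrictScalars 𝒪[K]) ≤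
      scaleLattice (ϖ ^ d) (latt ((κ : Matrix (Fin 3) (Fin 3) K) * !![a / ϖ, 0, 0; 0, 1, 0; b, 0, ϖ]))) :
    Valued.v (((((κ⁻¹ : GL (Fin 3) K)) : Matrix (Fin 3) (Fin 3) K) * ((γ : Matrix (Fin 3) (Fin 3) K) - 1) * (κ : Matrix (Fin 3) (Fin 3) K)) 1 0) ≤ Valued.v ϖ ^ (d + 1) ∧
      Valued.v (((((κ⁻¹ : GL (Fin 3) K)) : Matrix (Fin 3) (Fin 3) K) * ((γ : Matrix (Fin 3) (Fin 3) K) - 1) * (κ : Matrix (Fin 3) (Fin 3) K)) 2 1) ≤ Valued.v ϖ ^ (d + 1) ∧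
      Valued.v (((((κ⁻¹ : GL (Fin 3) K)) : Matrix (Fin 3) (Fin 3) K) * ((γ : Matrix (Fin 3) (Fin 3) K) - 1) * (κ : Matrix (Fin 3) (Fin 3) K)) 2 0) ≤ Valued.v ϖ ^ (d + 1) := by
  have hϖ0 : ϖ ≠ 0 := fun h0 => by rw [h0, map_zero] at hϖ; exact WithZero.coe_ne_zero hϖ.symm
  have ha0 : a ≠ 0 := fun h0 => by rw [h0, map_zero] at ha; exact zero_ne_one ha
  rw [map_toLin'_latt_le_scaleLattice_iff (pow_ne_zero _ hϖ0) _ (isUnit_det_coe_mul_childFrame κ hϖ0 ha0 b), inv_coe_mul_childFrame_conj_eq κ hϖ0 ha0, map_pow] at hlev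
  exact v_apply_le_succ_of_forall_v_childFrame_conj_le hϖ ha hb hd hM hlev

/-! ## §2 Residual nilpotency: an eigenline is a kernel line, so a null line off the kernel carries the pivot -/

/-- **On an eigenline `(M³)₀₀ ≡ M₀₀³`**: if `M` has level `ϖ^d` and `|M₁₀|, |M₂₀| ≤ |ϖ|^{d+1}` then `|(M³)₀₀ − M₀₀³| ≤ |ϖ|^{3d+1}` (every other term of the expansion of
`(M³)₀₀` passes through the first column below the diagonal). [cite: Kottwitz1986, §3] [cite: Tits1979, §3.5] -/
theorem v_mul_mul_apply_zero_zero_sub_le {d : ℕ} {M : Matrix (Fin 3) (Fin 3) K}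
    (hM : ∀ i j, Valued.v (M i j) ≤ Valued.v ϖ ^ d) (h10 : Valued.v (M 1 0) ≤ Valued.v ϖ ^ (d + 1)) (h20 : Valued.v (M 2 0) ≤ Valued.v ϖ ^ (d + 1)) :
    Valued.v ((M * M * M) 0 0 - M 0 0 * M 0 0 * M 0 0) ≤ Valued.v ϖ ^ (3 * d + 1) := by
  have hsum : Valued.v ϖ ^ (3 * d + 1) = Valued.v ϖ ^ d * Valued.v ϖ ^ d * Valued.v ϖ ^ (d + 1) := by rw [← pow_add, ← pow_add]; congr 1; omega
  -- a triple product with a small LAST factor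
  have h3 : ∀ {x y z : K}, Valued.v x ≤ Valued.v ϖ ^ d → Valued.v y ≤ Valued.v ϖ ^ d → Valued.v z ≤ Valued.v ϖ ^ (d + 1) →
      Valued.v (x * y * z) ≤ Valued.v ϖ ^ (3 * d + 1) := fun {x y z} hx hy hz => by
    rw [map_mul, map_mul, hsum]; exact mul_le_mul' (mul_le_mul' hx hy) hz
  have e : (M * M * M) 0 0 - M 0 0 * M 0 0 * M 0 0 =
      M 0 0 * M 0 1 * M 1 0 + M 0 0 * M 0 2 * M 2 0 +
      (M 0 1 * M 1 1 * M 1 0 + M 0 1 * M 1 2 * M 2 0 + M 0 1 * M 0 0 * M 1 0) +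
      (M 0 2 * M 2 1 * M 1 0 + M 0 2 * M 2 2 * M 2 0 + M 0 2 * M 0 0 * M 2 0) := by
    simp only [Matrix.mul_apply, Fin.sum_univ_three]; ring
  rw [e]
  refine (Valuation.map_add _ _ _).trans (max_le ((Valuation.map_add _ _ _).trans (max_le ((Valuation.map_add _ _ _).trans (max_le ?_ ?_)) ?_)) ?_)
  · exact h3 (hM 0 0) (hM 0 1) h10
  · exact h3 (hM 0 0) (hM 0 2) h20
  · exact (Valuation.map_add _ _ _).trans (max_le ((Valuation.map_add _ _ _).trans (max_le (h3 (hM 0 1) (hM 1 1) h10) (h3 (hM 0 1) (hM 1 2) h20)))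
      (h3 (hM 0 1) (hM 0 0) h10))
  · exact (Valuation.map_add _ _ _).trans (max_le ((Valuation.map_add _ _ _).trans (max_le (h3 (hM 0 2) (hM 2 1) h10) (h3 (hM 0 2) (hM 2 2) h20)))
      (h3 (hM 0 2) (hM 0 0) h20))

/-- **NILPOTENT + NULL + NOT KERNEL ⇒ PIVOT**: if `M` has level `ϖ^d`, `M³` has level `ϖ^{3d+1}` (residually nilpotent `Ȳ`), the line is null (`|M₂₀| ≤ |ϖ|^{d+1}`) and
`x̄ ∉ ker Ȳ` (NOT all of `M₀₀, M₁₀, M₂₀` are `≤ |ϖ|^{d+1}`), then the pivot holds: **`|M₁₀| = |ϖ|^d`** (else `ē₀` is an eigenvector of the nilpotent `Ȳ` with eigenvalue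
`ȳ₀₀ ≠ 0`, absurd as `(M³)₀₀ ≡ M₀₀³`). [cite: Kottwitz1986, §3] [cite: Tits1979, §3.5] [cite: BruhatTits1972, §10] -/
theorem v_one_zero_eq_of_cube_le_of_corner (hϖ : Valued.v ϖ = WithZero.exp (-1 : ℤ)) {d : ℕ} {M : Matrix (Fin 3) (Fin 3) K}
    (hM : ∀ i j, Valued.v (M i j) ≤ Valued.v ϖ ^ d) (hcube : ∀ i j, Valued.v ((M * M * M) i j) ≤ Valued.v ϖ ^ (3 * d + 1))
    (h20 : Valued.v (M 2 0) ≤ Valued.v ϖ ^ (d + 1)) (hcol : ¬ ∀ i, Valued.v (M i 0) ≤ Valued.v ϖ ^ (d + 1)) :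
    Valued.v (M 1 0) = Valued.v ϖ ^ d := by
  have hϖ0 : ϖ ≠ 0 := fun h0 => by rw [h0, map_zero] at hϖ; exact WithZero.coe_ne_zero hϖ.symm
  have hvϖ0 : Valued.v ϖ ≠ 0 := (Valuation.ne_zero_iff _).2 hϖ0
  have hϖlt : Valued.v ϖ < 1 := by rw [hϖ, ← WithZero.exp_zero]; exact WithZero.exp_lt_exp.2 (by norm_num)
  -- discreteness: `≤ |ϖ|^d` and `≠ |ϖ|^d` means `≤ |ϖ|^(d+1)`
  have hstep : ∀ {x : K}, Valued.v x ≤ Valued.v ϖ ^ d → Valued.v x ≠ Valued.v ϖ ^ d → Valued.v x ≤ Valued.v ϖ ^ (d + 1) := fun {x} hx hne => by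
    have hlt : Valued.v x < Valued.v ϖ ^ d := lt_of_le_of_ne hx hne
    have hdm : Valued.v ϖ ^ d = Valued.v ϖ ^ (d + 1) * WithZero.exp (1 : ℤ) := by
      rw [pow_succ, hϖ, mul_assoc, ← WithZero.exp_add]; norm_num
    rw [hdm] at hlt
    exact (WithZero.lt_mul_exp_iff_le (pow_ne_zero _ hvϖ0)).1 hlt
  by_contra hne
  have h10 : Valued.v (M 1 0) ≤ Valued.v ϖ ^ (d + 1) := hstep (hM 1 0) hne
  -- then `M₀₀` must be the unit entry of the column
  have h00 : Valued.v (M 0 0) = Valued.v ϖ ^ d := by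
    by_contra hne0
    apply hcol
    intro i
    fin_cases i
    · exact hstep (hM 0 0) hne0
    · exact h10
    · exact h20
  -- `(M³)₀₀ = M₀₀³ + small` has exact size `|ϖ|^(3d)`, contradicting the nilpotency token
  have hsub := v_mul_mul_apply_zero_zero_sub_le (ϖ := ϖ) hM h10 h20
  have hcube0 : Valued.v (M 0 0 * M 0 0 * M 0 0) = Valued.v ϖ ^ (3 * d) := by
    rw [map_mul, map_mul, h00, ← pow_add, ← pow_add]; congr 1; omega
  have hlt : Valued.v ϖ ^ (3 * d + 1) < Valued.v ϖ ^ (3 * d) := by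
    rw [pow_succ]; exact mul_lt_of_lt_one_right (zero_lt_iff.2 (pow_ne_zero _ hvϖ0)) hϖlt
  have hbig : Valued.v ((M * M * M) 0 0) = Valued.v ϖ ^ (3 * d) := by
    have e : (M * M * M) 0 0 = ((M * M * M) 0 0 - M 0 0 * M 0 0 * M 0 0) + M 0 0 * M 0 0 * M 0 0 := by ring
    rw [e, Valuation.map_add_eq_of_lt_right _ ((hsub.trans_lt hlt).trans_eq hcube0.symm), hcube0]
  exact (lt_irrefl _) (((hcube 0 0).trans_lt hlt).trans_eq hbig.symm)

/-! ## §3 The token corollary: through an outward null line off the kernel the child is `(d − 1, rank 2)` -/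

omit [Valued K ℤᵐ⁰] in
/-- `G⁻¹A³G = (G⁻¹AG)³` for invertible `G`. [cite: Serre1980Trees, II.1.1] -/
theorem inv_mul_pow_three_mul_eq {N : ℕ} (A : Matrix (Fin N) (Fin N) K) {G : Matrix (Fin N) (Fin N) K} (hG : IsUnit G.det) :
    G⁻¹ * A ^ 3 * G = (G⁻¹ * A * G) * (G⁻¹ * A * G) * (G⁻¹ * A * G) := by
  rw [pow_succ]
  calc G⁻¹ * (A ^ 2 * A) * G = G⁻¹ * A ^ 2 * (G * G⁻¹) * A * G := by rw [Matrix.mul_nonsing_inv _ hG, Matrix.mul_one]; simp only [Matrix.mul_assoc]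
    _ = (G⁻¹ * A ^ 2 * G) * (G⁻¹ * A * G) := by simp only [Matrix.mul_assoc]
    _ = (G⁻¹ * A * G) * (G⁻¹ * A * G) * (G⁻¹ * A * G) := by rw [inv_mul_sq_mul_eq_sq A hG, pow_two]

/-- **THE CHILD THROUGH AN OUTWARD NULL LINE OFF THE KERNEL HAS DEPTH EXACTLY `d − 1` AND RANK 2** (tokens): for UNITARY `κ, γ` (`σ` valuation-preserving), the vertex
`κ·L₀` with `LEV (ϖ^d)` (`d ≥ 1`) and residual nilpotency `(γ−1)³·(κ·L₀) ⊆ ϖ^{3d+1}·(κ·L₀)`, and a line `x̄ = κe₀` which is `Q_Ȳ`-null (`|M₂₀| ≤ |ϖ|^{d+1}`,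
`M = κ⁻¹(γ−1)κ`) and NOT in the kernel (`¬ ∀ i, |M_{i0}| ≤ |ϖ|^{d+1}`): the child `Λ′ = latt(κ·g(a,b))` has `¬ LEV (ϖ^d)` and `¬ LEV₂ (ϖ^{2d−1})` — label `(d−1, 2)`.
[cite: Kottwitz1986, §3] [cite: Tits1979, §3.5] [cite: BruhatTits1972, §10] -/
theorem not_lev_and_not_lev₂_childLatt_of_cube_le (hvσ : ∀ z, Valued.v (σ z) = Valued.v z) (hϖ : Valued.v ϖ = WithZero.exp (-1 : ℤ))
    (κ γ : unitaryGroupOfForm σ ((StdForm.antidiagonal 3).over K)) {a b : K} (ha : Valued.v a = 1) (hb : Valued.v b ≤ 1) {d : ℕ} (hd : 1 ≤ d)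
    (hlev : (latt ((κ : GL (Fin 3) K) : Matrix (Fin 3) (Fin 3) K)).map ((Matrix.toLin' (((γ : GL (Fin 3) K) : Matrix (Fin 3) (Fin 3) K) - 1)).restrictScalars 𝒪[K]) ≤
      scaleLattice (ϖ ^ d) (latt ((κ : GL (Fin 3) K) : Matrix (Fin 3) (Fin 3) K)))
    (hnil : (latt ((κ : GL (Fin 3) K) : Matrix (Fin 3) (Fin 3) K)).map ((Matrix.toLin' ((((γ : GL (Fin 3) K) : Matrix (Fin 3) (Fin 3) K) - 1) ^ 3)).restrictScalars 𝒪[K]) ≤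
      scaleLattice (ϖ ^ (3 * d + 1)) (latt ((κ : GL (Fin 3) K) : Matrix (Fin 3) (Fin 3) K)))
    (h20 : Valued.v (((((κ : GL (Fin 3) K)⁻¹ : GL (Fin 3) K) : Matrix (Fin 3) (Fin 3) K) * (((γ : GL (Fin 3) K) : Matrix (Fin 3) (Fin 3) K) - 1) *
      ((κ : GL (Fin 3) K) : Matrix (Fin 3) (Fin 3) K)) 2 0) ≤ Valued.v ϖ ^ (d + 1))
    (hcol : ¬ ∀ i, Valued.v (((((κ : GL (Fin 3) K)⁻¹ : GL (Fin 3) K) : Matrix (Fin 3) (Fin 3) K) * (((γ : GL (Fin 3) K) : Matrix (Fin 3) (Fin 3) K) - 1) *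
      ((κ : GL (Fin 3) K) : Matrix (Fin 3) (Fin 3) K)) i 0) ≤ Valued.v ϖ ^ (d + 1)) :
    ¬ (latt (((κ : GL (Fin 3) K) : Matrix (Fin 3) (Fin 3) K) * !![a / ϖ, 0, 0; 0, 1, 0; b, 0, ϖ])).map
          ((Matrix.toLin' (((γ : GL (Fin 3) K) : Matrix (Fin 3) (Fin 3) K) - 1)).restrictScalars 𝒪[K]) ≤
          scaleLattice (ϖ ^ d) (latt (((κ : GL (Fin 3) K) : Matrix (Fin 3) (Fin 3) K) * !![a / ϖ, 0, 0; 0, 1, 0; b, 0, ϖ])) ∧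
      ¬ (latt (((κ : GL (Fin 3) K) : Matrix (Fin 3) (Fin 3) K) * !![a / ϖ, 0, 0; 0, 1, 0; b, 0, ϖ])).map
          ((Matrix.toLin' ((((γ : GL (Fin 3) K) : Matrix (Fin 3) (Fin 3) K) - 1) ^ 2)).restrictScalars 𝒪[K]) ≤
          scaleLattice (ϖ ^ (2 * d - 1)) (latt (((κ : GL (Fin 3) K) : Matrix (Fin 3) (Fin 3) K) * !![a / ϖ, 0, 0; 0, 1, 0; b, 0, ϖ])) := by
  have hϖ0 : ϖ ≠ 0 := fun h0 => by rw [h0, map_zero] at hϖ; exact WithZero.coe_ne_zero hϖ.symm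
  have hκ : IsUnit ((κ : GL (Fin 3) K) : Matrix (Fin 3) (Fin 3) K).det := Matrix.isUnits_det_units _
  -- the matrix `M = κ⁻¹(γ−1)κ`: `(κ : Matrix)⁻¹ = ((κ⁻¹ : GL) : Matrix)`
  have hinv : ((κ : GL (Fin 3) K) : Matrix (Fin 3) (Fin 3) K)⁻¹ = (((κ : GL (Fin 3) K)⁻¹ : GL (Fin 3) K) : Matrix (Fin 3) (Fin 3) K) := (Matrix.coe_units_inv _).symm
  rw [map_toLin'_latt_le_scaleLattice_iff (pow_ne_zero _ hϖ0) _ hκ, hinv, map_pow] at hlev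
  rw [map_toLin'_latt_le_scaleLattice_iff (pow_ne_zero _ hϖ0) _ hκ, inv_mul_pow_three_mul_eq _ hκ, hinv, map_pow] at hnil
  have hpiv := v_one_zero_eq_of_cube_le_of_corner hϖ hlev hnil h20 hcol
  refine ⟨not_map_sub_one_childLatt_le_scaleLattice_of_pivot hϖ (κ : GL (Fin 3) K) (γ : GL (Fin 3) K) ha hb hd hlev hpiv, fun h => ?_⟩
  exact ((map_sub_one_sq_childLatt_le_scaleLattice_iff_of_corner hvσ hϖ κ γ ha hb hd hlev h20).1 h) hpiv

end Literature.NumberTheory.Automorphic.UnitaryLatticeTree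

end
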